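import Summits.QuantumFields.QCD.Theorems.HeatSlicedQuarksQuarkLoopCoefficientSecondOrderCoefficientAuxC

/-!
# Quark-loop coefficient, stub `secondOrderCoefficient`, part D: the collapsed formula for `e2`

Helper file of the line `Sketch` of crux stmt-QuantumFields-16786 (stub `stub_secondOrderCoefficient`:
`e2 t → 1/(12π²)` at rate `C/t`).  Combining the trace formulas of part B with the single-momentum
collapse of part C: for `0 ≤ s ≤ t`, `0 < t` the `w`-sum of the second-order integrand
`k_{t−s}(w){tr[vtx 2 (E₀(s))(w)] + tr[vtx 1 (E₁(s))(w)]}` is an explicit finite combination of values of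
`k_t`, polynomial in `s`; integrating `∫₀ᵗ ds` gives the closed formula `e2_eq_collapsed`:
`e2 t = −(t·A₀ + (t²/6)·A₁ + (t²/2)·A₂)` with three finite sums `A₀, A₁, A₂` of values of `k_t`
(hypotheses: conjuncts (1), (3), (5), (6), (7) of the line's `FreeHeatCalculus`).
Mathlib + the Defs file + parts A–C.
-/

noncomputable section

namespace Summit.QuantumFields.QCD.Cruxes.QuarkLoopCoefficient.Sketch.SecondOrderCoefficient

open Literature.MathematicalPhysics.QuantumLattice Literature.MathematicalPhysics.QuantumFieldTheory
open Literature.Probability.LatticeModels (Site)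
open Summit.QuantumFields.QCD.Theorems.QuarkLoopCoefficient
open Summit.QuantumFields.QCD.Cruxes.QuarkLoopCoefficient.Sketch.HeatSeries
open scoped Matrix ComplexConjugate

attribute [local irreducible] nbr nbr2

/-! ## The collapsed integrand and the closed formula for `e2` -/

section Formula

variable
  (hsq : ∀ x y : Site 4, sqKer (fun _ => (1 : ℂ)) x y = ((hhat (y - x) : ℝ) : ℂ) • (1 : Spin))
  (hδ : ∀ w : Site 4, freeKer 0 w = if w = 0 then 1 else 0)
  (hsemi : ∀ s r : ℝ, 0 ≤ s → 0 ≤ r → ∀ w : Site 4,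
    HasSum (fun y : Site 4 => freeKer s y * freeKer r (w - y)) (freeKer (s + r) w))
  (hibp : ∀ t : ℝ, 0 ≤ t → ∀ (w : Site 4) (ν : Fin 4),
    t * (∑ z ∈ nbr2 0, ((z ν : ℤ) : ℝ) * hhat z * freeKer t (w - z)) + ((w ν : ℤ) : ℝ) * freeKer t w = 0)
  (heven : ∀ (t : ℝ) (w : Site 4), freeKer t (-w) = freeKer t w)
include hsemi hibp heven

/-- The `w`-sum of the second-order vertex weight `(z∧v + v∧w)² k_s(w − v)` against `k_{t−s}(w)`:
`(z∧v)² k_t(v) − s(t−s)/t · Σ_{z'} ĥ(z') (v∧z')² k_t(v + z')` (`0 ≤ s ≤ t`, `0 < t`). -/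
theorem hasSum_vertexTwo_weight {t s : ℝ} (ht : 0 < t) (hs0 : 0 ≤ s) (hst : s ≤ t) (v z : Site 4) :
    HasSum (fun w : Site 4 => freeKer (t - s) w * (((wedge z v + wedge v w : ℤ) : ℝ) ^ 2 * freeKer s (w - v)))
      (((wedge z v : ℤ) : ℝ) ^ 2 * freeKer t v -
        s * ((t - s) / t) * ∑ z' ∈ nbr2 0, hhat z' * ((wedge v z' : ℤ) : ℝ) ^ 2 * freeKer t (v + z')) := by
  have ha : 0 ≤ t - s := sub_nonneg.mpr hst
  have hab : 0 < t - s + s := by rw [sub_add_cancel]; exact ht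
  have h0 := (hasSum_ker_mul_ker hsemi heven ha hs0 v).mul_left (((wedge z v : ℤ) : ℝ) ^ 2)
  have h1 := (hasSum_ker_wedge_ker hsemi hibp heven ha hs0 hab v v).mul_left (2 * ((wedge z v : ℤ) : ℝ))
  have h2 := hasSum_ker_wedge_sq_ker hsemi hibp heven ha hs0 hab v v
  rw [sub_add_cancel] at h0 h1 h2
  refine hasSum_of_eq ((h0.add h1).add h2) (fun w => ?_) ?_
  · push_cast; ring
  · rw [SecondOrderExpansion.wedge_self]; push_cast; ring

include hsq hδ in
/-- **Single-momentum collapse.**  For `0 ≤ s ≤ t`, `0 < t`, the `w`-sum of the second-order integrand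
`k_{t−s}(w)·{tr[vtx 2 (E₀(s))(w)] + tr[vtx 1 (E₁(s))(w)]}` is a finite combination of values of `k_t`. -/
theorem hasSum_integrand {t s : ℝ} (ht : 0 < t) (hs0 : 0 ≤ s) (hst : s ≤ t) :
    HasSum (fun w : Site 4 => ((freeKer (t - s) w : ℝ) : ℂ) *
        ((vtx 2 (pert0 s) w).trace + (vtx 1 (pert1 s) w).trace))
      ((∑ v ∈ nbr2 0, ∑ z ∈ nbr 0, (-(dsharp z * dsymb (v - z)).trace / 8) *
          (((((wedge z v : ℤ) : ℝ) ^ 2 * freeKer t v -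
            s * ((t - s) / t) * ∑ z' ∈ nbr2 0, hhat z' * ((wedge v z' : ℤ) : ℝ) ^ 2 * freeKer t (v + z')) : ℝ) : ℂ)) +
        ∑ v ∈ nbr2 0, ∑ v' ∈ nbr2 0,
          ((-(s : ℂ) * ((∑ z ∈ nbr 0, (Complex.I / 2 * ((wedge z v : ℤ) : ℂ)) • (dsharp z * dsymb (v - z))) *
              (∑ z ∈ nbr 0, (Complex.I / 2 * ((wedge z v' : ℤ) : ℂ)) • (dsharp z * dsymb (v' - z)))).trace) *
              ((freeKer t (v + v') : ℝ) : ℂ) +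
            (-(s : ℂ) * (Complex.I / 2 * ((hhat v : ℝ) : ℂ) *
              (∑ z ∈ nbr 0, (Complex.I / 2 * ((wedge z v' : ℤ) : ℂ)) • (dsharp z * dsymb (v' - z))).trace)) *
              ((((t - s) / t * ((wedge v (v + v') : ℤ) : ℝ) * freeKer t (v + v')) : ℝ) : ℂ))) := by
  have ha : 0 ≤ t - s := sub_nonneg.mpr hst
  have hab : 0 < t - s + s := by rw [sub_add_cancel]; exact ht
  -- the integrand, term by term
  have hfun : ∀ w : Site 4, ((freeKer (t - s) w : ℝ) : ℂ) *
      ((vtx 2 (pert0 s) w).trace + (vtx 1 (pert1 s) w).trace) =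
      (∑ v ∈ nbr2 0, ∑ z ∈ nbr 0, (-(dsharp z * dsymb (v - z)).trace / 8) *
        (((freeKer (t - s) w * (((wedge z v + wedge v w : ℤ) : ℝ) ^ 2 * freeKer s (w - v))) : ℝ) : ℂ)) +
      ∑ v ∈ nbr2 0, ∑ v' ∈ nbr2 0,
        ((-(s : ℂ) * ((∑ z ∈ nbr 0, (Complex.I / 2 * ((wedge z v : ℤ) : ℂ)) • (dsharp z * dsymb (v - z))) *
            (∑ z ∈ nbr 0, (Complex.I / 2 * ((wedge z v' : ℤ) : ℂ)) • (dsharp z * dsymb (v' - z)))).trace) *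
            (((freeKer (t - s) w * freeKer s (w - (v + v'))) : ℝ) : ℂ) +
          (-(s : ℂ) * (Complex.I / 2 * ((hhat v : ℝ) : ℂ) *
            (∑ z ∈ nbr 0, (Complex.I / 2 * ((wedge z v' : ℤ) : ℂ)) • (dsharp z * dsymb (v' - z))).trace)) *
            (((freeKer (t - s) w * (((wedge v w : ℤ) : ℝ) * freeKer s (w - (v + v')))) : ℝ) : ℂ)) := by
    intro w
    rw [trace_vtx_two_pert0, trace_vtx_one_pert1 hsq hδ hsemi hibp hs0, mul_add, Finset.mul_sum, Finset.mul_sum,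
      Finset.mul_sum]
    congr 1
    · refine Finset.sum_congr rfl fun v _ => ?_
      rw [Finset.mul_sum]
      refine Finset.sum_congr rfl fun z _ => ?_
      push_cast; ring
    · refine Finset.sum_congr rfl fun v _ => ?_
      rw [Finset.mul_sum, Finset.mul_sum]
      refine Finset.sum_congr rfl fun v' _ => ?_
      rw [sub_sub]; push_cast; ring
  simp only [hfun]
  refine HasSum.add (hasSum_sum fun v _ => hasSum_sum fun z _ => ?_)
    (hasSum_sum fun v _ => hasSum_sum fun v' _ => HasSum.add ?_ ?_)
  · exact (Complex.hasSum_ofReal.mpr (hasSum_vertexTwo_weight hsemi hibp heven ht hs0 hst v z)).mul_left _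
  · have h := hasSum_ker_mul_ker hsemi heven ha hs0 (v + v')
    rw [sub_add_cancel] at h
    exact (Complex.hasSum_ofReal.mpr h).mul_left _
  · have h := hasSum_ker_wedge_ker hsemi hibp heven ha hs0 hab v (v + v')
    rw [sub_add_cancel] at h
    exact (Complex.hasSum_ofReal.mpr h).mul_left _

omit hsemi hibp heven in
/-- `∫₀ᵗ s(t−s)/t ds = t²/6`. -/
theorem integral_mul_sub_div {t : ℝ} (ht : 0 < t) : ∫ s in (0 : ℝ)..t, s * (t - s) / t = t ^ 2 / 6 := by
  have ht0 : t ≠ 0 := ht.ne'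
  have hderiv : ∀ x ∈ Set.uIcc 0 t, HasDerivAt (fun s => s ^ 2 / 2 - s ^ 3 / (3 * t)) (x * (t - x) / t) x := by
    intro x _
    refine (((hasDerivAt_pow 2 x).div_const 2).sub ((hasDerivAt_pow 3 x).div_const (3 * t))).congr_deriv ?_
    field_simp
    ring
  rw [intervalIntegral.integral_eq_sub_of_hasDerivAt hderiv (by apply Continuous.intervalIntegrable; fun_prop)]
  field_simp
  ring

include hsq hδ in
/-- **The collapsed second-order coefficient.**  For `t > 0`,
`e2 t = −(t·A₀ + (t²/6)·A₁ + (t²/2)·A₂)` with the three finite combinations of values of `k_t` below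
(the `s`-integrals are `∫₀ᵗ 1 = t`, `∫₀ᵗ s(t−s)/t = t²/6`, `∫₀ᵗ s = t²/2`). -/
theorem e2_eq_collapsed {t : ℝ} (ht : 0 < t) :
    e2 t = -((t : ℂ) *
        (∑ v ∈ nbr2 0, ∑ z ∈ nbr 0, (-(dsharp z * dsymb (v - z)).trace / 8) *
          (((((wedge z v : ℤ) : ℝ) ^ 2 * freeKer t v) : ℝ) : ℂ)) +
      ((t ^ 2 / 6 : ℝ) : ℂ) *
        ((∑ v ∈ nbr2 0, ∑ z ∈ nbr 0, ((dsharp z * dsymb (v - z)).trace / 8) *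
            (((∑ z' ∈ nbr2 0, hhat z' * ((wedge v z' : ℤ) : ℝ) ^ 2 * freeKer t (v + z')) : ℝ) : ℂ)) +
          ∑ v ∈ nbr2 0, ∑ v' ∈ nbr2 0, (-(Complex.I / 2 * ((hhat v : ℝ) : ℂ) *
              (∑ z ∈ nbr 0, (Complex.I / 2 * ((wedge z v' : ℤ) : ℂ)) • (dsharp z * dsymb (v' - z))).trace)) *
            (((((wedge v (v + v') : ℤ) : ℝ) * freeKer t (v + v')) : ℝ) : ℂ)) +
      ((t ^ 2 / 2 : ℝ) : ℂ) *
        (∑ v ∈ nbr2 0, ∑ v' ∈ nbr2 0,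
          (-((∑ z ∈ nbr 0, (Complex.I / 2 * ((wedge z v : ℤ) : ℂ)) • (dsharp z * dsymb (v - z))) *
              (∑ z ∈ nbr 0, (Complex.I / 2 * ((wedge z v' : ℤ) : ℂ)) • (dsharp z * dsymb (v' - z)))).trace) *
            ((freeKer t (v + v') : ℝ) : ℂ))) := by
  -- abbreviate the three finite sums
  set A0 : ℂ := ∑ v ∈ nbr2 0, ∑ z ∈ nbr 0, (-(dsharp z * dsymb (v - z)).trace / 8) *
    (((((wedge z v : ℤ) : ℝ) ^ 2 * freeKer t v) : ℝ) : ℂ) with hA0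
  set A1a : ℂ := ∑ v ∈ nbr2 0, ∑ z ∈ nbr 0, ((dsharp z * dsymb (v - z)).trace / 8) *
    (((∑ z' ∈ nbr2 0, hhat z' * ((wedge v z' : ℤ) : ℝ) ^ 2 * freeKer t (v + z')) : ℝ) : ℂ) with hA1a
  set A1b : ℂ := ∑ v ∈ nbr2 0, ∑ v' ∈ nbr2 0, (-(Complex.I / 2 * ((hhat v : ℝ) : ℂ) *
      (∑ z ∈ nbr 0, (Complex.I / 2 * ((wedge z v' : ℤ) : ℂ)) • (dsharp z * dsymb (v' - z))).trace)) *
    (((((wedge v (v + v') : ℤ) : ℝ) * freeKer t (v + v')) : ℝ) : ℂ) with hA1b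
  set A2 : ℂ := ∑ v ∈ nbr2 0, ∑ v' ∈ nbr2 0,
    (-((∑ z ∈ nbr 0, (Complex.I / 2 * ((wedge z v : ℤ) : ℂ)) • (dsharp z * dsymb (v - z))) *
        (∑ z ∈ nbr 0, (Complex.I / 2 * ((wedge z v' : ℤ) : ℂ)) • (dsharp z * dsymb (v' - z)))).trace) *
    ((freeKer t (v + v') : ℝ) : ℂ) with hA2
  -- the integrand on `[0, t]`
  have hint : Set.EqOn (fun s : ℝ => ∑' w : Site 4, ((freeKer (t - s) w : ℝ) : ℂ) *
      ((vtx 2 (pert0 s) w).trace + (vtx 1 (pert1 s) w).trace))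
      (fun s : ℝ => A0 + ((s * (t - s) / t : ℝ) : ℂ) * (A1a + A1b) + ((s : ℝ) : ℂ) * A2) (Set.uIcc 0 t) := by
    intro s hs
    rw [Set.uIcc_of_le ht.le] at hs
    obtain ⟨hs0, hst⟩ := hs
    simp only []
    rw [(hasSum_integrand hsq hδ hsemi hibp heven ht hs0 hst).tsum_eq,
      show A0 + ((s * (t - s) / t : ℝ) : ℂ) * (A1a + A1b) + ((s : ℝ) : ℂ) * A2 =
        (A0 + ((s * (t - s) / t : ℝ) : ℂ) * A1a) + (((s * (t - s) / t : ℝ) : ℂ) * A1b + ((s : ℝ) : ℂ) * A2) by ring]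
    congr 1
    · conv_rhs => rw [hA0, hA1a, Finset.mul_sum, ← Finset.sum_add_distrib]
      refine Finset.sum_congr rfl fun v _ => ?_
      conv_rhs => rw [Finset.mul_sum, ← Finset.sum_add_distrib]
      refine Finset.sum_congr rfl fun z _ => ?_
      push_cast
      ring
    · conv_rhs => rw [hA1b, hA2, Finset.mul_sum, Finset.mul_sum, ← Finset.sum_add_distrib]
      refine Finset.sum_congr rfl fun v _ => ?_
      conv_rhs => rw [Finset.mul_sum, Finset.mul_sum, ← Finset.sum_add_distrib]
      refine Finset.sum_congr rfl fun v' _ => ?_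
      push_cast
      ring
  unfold e2
  rw [intervalIntegral.integral_congr hint, intervalIntegral.integral_add, intervalIntegral.integral_add,
    intervalIntegral.integral_const, intervalIntegral.integral_mul_const, intervalIntegral.integral_mul_const,
    intervalIntegral.integral_ofReal, intervalIntegral.integral_ofReal, integral_id, integral_mul_sub_div ht,
    sub_zero, Complex.real_smul]
  · push_cast
    ring
  · exact intervalIntegrable_const
  · exact Continuous.intervalIntegrable (by fun_prop) _ _
  · exact Continuous.intervalIntegrable (by fun_prop) _ _
  · exact Continuous.intervalIntegrable (by fun_prop) _ _

end Formula

/-! ## Registered headline -/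

/-- Registered headline of this helper file (aux stub `stub_secondOrderCoefficientAuxD` of crux
stmt-QuantumFields-16786, line `Sketch`): `∫₀ᵗ s(t−s)/t ds = t²/6`. -/
theorem stub_secondOrderCoefficientAuxD :
    ∀ (t : ℝ), 0 < t → ∫ s in (0 : ℝ)..t, s * (t - s) / t = t ^ 2 / 6 :=
  fun _ ht => integral_mul_sub_div ht

end Summit.QuantumFields.QCD.Cruxes.QuarkLoopCoefficient.Sketch.SecondOrderCoefficient

end
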